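import Summits.BirchSwinnertonDyer.BirchSwinnertonDyer.Theorems.GenusKolyvaginAtTwoEquivariantKolyvaginExactAtTwoReciprocityRat
import Literature.NumberTheory.GaloisRepresentations.ContinuousH1ResCocycle
import HarnessLib

/-!
# Route `GenusKolyvaginAtTwo`, crux L_T `PowDvdShaCardAtTwoRT` (stmt-BirchSwinnertonDyer-23242), LINE 18/19 stub 3a⁗,
# step (b) input I7 AT `p = 2` OVER `ℚ_ℓ`: THE TRANSVERSE LINE AT A KOLYVAGIN PRIME IS ISOTROPIC

Seat `bsd-line-gk2-p3` g19 (PROVER seat 3/3, cell `bsd-f1-sign2`), `--supports 23242 --as helper`. THEOREMS ONLY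
(no definition, no named fact, no `sorry`). BSD is not proved by any of this; neither is the crux.

McCallum 1991 (LMS LN 153), Lemma 5.3, last clause: «`im χ_l` is an isotropic subgroup of `H¹(K_λ, E_{p^M})`» —
used in the proof of Prop. 5.2 (p. 309: «If `v = v_λ ∈ S − {λ₀}`, then `c_v ∈ im(χ_l)` by (9), so again
`c_{M_r+1}(nl′)_v ∪ c_v = 0`») to kill the reciprocity terms at the OWN primes of `n`. McCallum's proof («the cup
product is skew symmetric and `Gal(K/ℚ)`-equivalent») is an odd-`p` argument. Memo
`Cruxes/PowDvdShaCardAtTwoRT/Lines/plus-descent-step-b-prop52.md` (gk2-p2 g15) lists this as input **I7** of the swap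
oracle of 3a⁗ («NOT typed; isotropy is NOT automatic at 2») for LINE 18, which runs McCallum §5 OVER `ℚ`.

SETTING (`h1Eval` / `weilContPairing` currency of `…FrobeniusCriterion`, `…Lemma53Rat`, `…ReciprocityRat`): `F ∈ Γ_ℚ`
an arithmetic Frobenius at the prime `𝔓 ∣ ℓ` of the chosen embedding, inverting `μ_q` (`q = p^M`) and acting on
`T = E[q]` as a REGULAR involution (`T` free of rank one over `ℤ/q[F]` on `P`; automatic on `Δ(E) < 0`,
`exists_regular_generator_of_Δ_neg`), `I_𝔓` fixing `T`. Call `x ∈ H¹(ℚ, E[q])` TRANSVERSE AT `ℓ` when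
`[x, F] ∈ (F − 1)T`: for unramified `x` this is `x_ℓ = 0` (`mem_torsionLocalKer_iff_exists_h1Eval_eq_smul_sub`); in
general it says the unramified component of `x_ℓ` vanishes — the `ℚ_ℓ`-descent of McCallum's `im χ_l`, cyclic of order
`q` in `H¹(ℚ_ℓ, E[q])` of order `q²`; it depends neither on `F` nor on the cocycle (tame values and coboundary values
lie in `T^{F=−1} = (F − 1)T`).

* §0 `cupClass_eq_zero_of_toLin_apply_eq_zero` — cochain-level vanishing of a cup product (`ContPairing`).
* §1 `pairing_eq_zero_of_smul_eq_neg` — for `T` regular on `P` and `e` alternating, the line `T^{F=−1} = ℤ(P − FP)` is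
  `e`-ISOTROPIC (pure algebra; FALSE for non-regular `F`: `Δ > 0`, `M = 1`, `T^{F=−1} = E[2]` with `e₂` non-degenerate).
* §2 `smul_h1Eval_resGal_eq_neg_of_transverse` — for `x` transverse, every value `[x, res g]`, `g ∈ Γ_{ℚ_ℓ}`, lies in
  `T^{F=−1}`: `G_𝔓 = ⟨F⟩·I_𝔓·U` (`exists_eq_frobenius_pow_mul_of_mem_decompositionSubgroup`), `[x, F^k] = F^k P₁ − P₁`,
  tame values anti-invariant (`smul_h1Eval_eq_neg_of_mem_inertia`, Kummer theory of `ℓ^{1/q}`), `F² = 1` on `T`.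
* §3 **`cupProduct_localization_eq_zero_of_transverse`** — `x, y` transverse ⟹ `loc_ℓ x ∪ₑ loc_ℓ y = 0` in
  `H²(ℚ_ℓ, μ_q)`: the cup-product `2`-cochain `⟨f b − f a, g c − g b⟩` is identically zero. No Brauer group / Hilbert
  symbol / local duality; over `K_λ` (`im χ_l ≅ E[q]` two-dimensional) one would need `(ℓ, ℓ)_q = 1`, and restricting
  from `ℚ_ℓ` to `K_λ` loses one bit (`inv_λ ∘ res = 2 inv_ℓ`).
* §4 `cupProduct_localization_eq_zero_of_transverse_of_Δ_neg`, `inv_…` — packaged on `Δ(E) < 0` at a Gross–Kolyvagin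
  prime of depth `M` (`p = 2`, `FrobEqFrobInfty W K (2^M) ℓ`), transversality quantified over all `𝔓 ∣ ℓ`, `F`, `c₀` like
  the hypothesis `hR` of `lemma_5_3_descent_of_reciprocity_rat_two`; `inv`-form = the `ℓ`-term of
  `sum_inv_weilCupProduct_localization_eq_zero`.
* §5 bridges: `transverse_of_norm_h1Eval_eq_zero` / `transverse_of_h1Eval_sq_eq_zero` (`[x, F²] = 0 ⟹` transverse —
  the shape for a class restricting over `K` to a Kolyvagin class `c_M(n)`, `ℓ ∣ n`, since `F² ↦ 1` in the dihedral
  group `Gal(K_λ(ℓ^{1/q})/ℚ_ℓ)`).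

References: [McCallumLMS1991] §4 Prop. 4.4, §5 Lemma 5.3, proof of Prop. 5.2 (pp. 305, 308–309); [GrossLMS1991] §3
(3.2)–(3.3), §7 (7.2); [NeukirchSchmidtWingberg2008] I §4.
-/

set_option autoImplicit false
set_option linter.dupNamespace false -- tree convention: `Summit.BirchSwinnertonDyer.BirchSwinnertonDyer.Theorems` (summit = sub-problem)

noncomputable section
open scoped Classical Pointwise
universe u v

namespace Summit.BirchSwinnertonDyer.BirchSwinnertonDyer.Theorems.GenusExact.TransverseIsotropy

open WeierstrassCurve NumberField IsDedekindDomain Field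
open Literature.NumberTheory.EllipticCurves Literature.NumberTheory.GaloisRepresentations
open Literature.NumberTheory.GaloisCohomology
open Summit.BirchSwinnertonDyer.BirchSwinnertonDyer.Theorems.GenusExact.FrobeniusCriterion

/-! ## §0 Cochain-level vanishing of a cup product -/

section Cochain

variable {R : Type u} [CommRing R] [TopologicalSpace R] {G : Type v} [Group G] [TopologicalSpace G]
  [IsTopologicalGroup G] [LocallyCompactSpace G] {X Y Z : TopRep.{v} R G} (φ : ContPairing X Y Z)
  (f : contOneCocycles X) (g : contOneCocycles Y)

/-- **A cup product of two crossed homomorphisms whose values pair to zero vanishes** (on the nose: the homogeneous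
`2`-cochain `(a, b, c) ↦ ⟨f b − f a, g c − g b⟩` is identically `0`). [folklore] -/
theorem cupClass_eq_zero_of_toLin_apply_eq_zero (h : ∀ a b : G, φ.toLin (f.1 a) (g.1 b) = 0) :
    φ.cupClass f g = 0 := by
  unfold ContPairing.cupClass
  rw [cxClass_eq_zero_iff _ 2 3 up_nat_next_two 1 up_nat_prev_two]
  refine ⟨0, ?_⟩
  rw [map_zero]
  refine (Subtype.ext (ContinuousMap.ext fun a => ContinuousMap.ext fun b =>
    ContinuousMap.ext fun c => ?_)).symm
  have hl : φ.toLin (f.1 b - f.1 a) (g.1 c - g.1 b) = 0 := by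
    simp only [map_sub, LinearMap.sub_apply, h, sub_self]
  rw [ContPairing.cupTwoCochain_apply, hl]
  rfl

/-- The same on classes: **`[f] ∪ [g] = 0`** when the values of `f` and `g` pair to zero. [folklore] -/
theorem cupProduct_oneCocycleClass_eq_zero_of_toLin_apply_eq_zero (h : ∀ a b : G, φ.toLin (f.1 a) (g.1 b) = 0) :
    φ.cupProduct (oneCocycleClass X f) (oneCocycleClass Y g) = 0 := by
  rw [ContPairing.cupProduct_oneCocycleClass]
  exact cupClass_eq_zero_of_toLin_apply_eq_zero φ f g h

end Cochain
/-! ## §1 The anti-invariant line of a regular involution is isotropic -/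

section Algebra

variable {K : Type u} [Field K] (W : WeierstrassCurve K) {n : ℤ} {F : absoluteGaloisGroup K} {q : ℤ}
  {P : geomTorsion W n}

/-- **`T^{F = −1} = ℤ·(P − FP)` for `T` free of rank one over `ℤ/q[F]` on `P`** (`F` an involution on `T = E[n]`):
an element `l = xP + yFP` with `Fl = −l` has `q ∣ x + y`, hence `l = x(P − FP)`. [folklore] -/
theorem exists_eq_zsmul_sub_of_smul_eq_neg (hF : ∀ Q : geomTorsion W n, F • F • Q = Q) (hPq : q • P = 0)
    (hgen : ∀ Q : geomTorsion W n, ∃ x y : ℤ, Q = x • P + y • F • P)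
    (hfree : ∀ x y : ℤ, x • P + y • F • P = 0 → q ∣ x ∧ q ∣ y)
    {l : geomTorsion W n} (hl : F • l = -l) : ∃ x : ℤ, l = x • (P - F • P) := by
  obtain ⟨x, y, rfl⟩ := hgen l
  refine ⟨x, ?_⟩
  -- `F l + l = (x + y) P + (x + y) F P = 0`
  have hsum : (x + y) • P + (x + y) • F • P = 0 := by
    have h0 : F • (x • P + y • F • P) + (x • P + y • F • P) = 0 := by rw [hl, neg_add_cancel]
    rw [smul_add, smul_comm F x P, smul_comm F y (F • P), hF] at h0
    rw [← h0, add_smul, add_smul]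
    abel
  obtain ⟨k, hk⟩ := (hfree _ _ hsum).1
  have hy : y = q * k - x := by rw [← hk]; ring
  have hqFP : q • F • P = 0 := by rw [smul_comm, hPq, smul_zero]
  rw [hy, sub_smul, mul_comm, mul_smul, hqFP, smul_zero, zero_sub, smul_sub, sub_eq_add_neg]

/-- **The anti-invariant line is isotropic for an alternating pairing.** For `T = E[n]` free of rank one over `ℤ/q[F]`
on `P` (`F` an involution on `T`), a biadditive pairing `e` on `T` with `e(a, a) = 0`, and `l, l'` with `Fl = −l`,
`Fl' = −l'`: **`e(l, l') = 0`** (both are multiples of `P − FP`). This is the algebra of McCallum's Lemma 5.3 (last clause)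
over `ℚ_ℓ` at `p = 2`; it fails for non-regular `F` (`Δ > 0`, `M = 1`: `T^{F=−1} = E[2]`). [cite: McCallumLMS1991, §5 Lemma 5.3] -/
theorem pairing_eq_zero_of_smul_eq_neg (hF : ∀ Q : geomTorsion W n, F • F • Q = Q) (hPq : q • P = 0)
    (hgen : ∀ Q : geomTorsion W n, ∃ x y : ℤ, Q = x • P + y • F • P)
    (hfree : ∀ x y : ℤ, x • P + y • F • P = 0 → q ∣ x ∧ q ∣ y)
    {C : Type*} [AddCommGroup C] (e : geomTorsion W n →+ geomTorsion W n →+ C) (halt : ∀ a, e a a = 0)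
    {l l' : geomTorsion W n} (hl : F • l = -l) (hl' : F • l' = -l') : e l l' = 0 := by
  obtain ⟨x, rfl⟩ := exists_eq_zsmul_sub_of_smul_eq_neg W hF hPq hgen hfree hl
  obtain ⟨x', rfl⟩ := exists_eq_zsmul_sub_of_smul_eq_neg W hF hPq hgen hfree hl'
  set t := P - F • P
  calc e (x • t) (x' • t) = x' • e (x • t) t := map_zsmul _ _ _
    _ = x' • x • e t t := by rw [← AddMonoidHom.flip_apply e (x • t) t, map_zsmul, AddMonoidHom.flip_apply]
    _ = 0 := by rw [halt, smul_zero, smul_zero]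

/-- `F^k` acts on `T` as `1` or as `F` when `F² = 1` on `T`. [folklore] -/
theorem pow_smul_eq_or (hF : ∀ Q : geomTorsion W n, F • F • Q = Q) (k : ℕ) :
    (∀ Q : geomTorsion W n, F ^ k • Q = Q) ∨ (∀ Q : geomTorsion W n, F ^ k • Q = F • Q) := by
  induction k with
  | zero => exact Or.inl fun Q ↦ by rw [pow_zero, one_smul]
  | succ k ih =>
    rcases ih with h | h
    · exact Or.inr fun Q ↦ by rw [pow_succ, mul_smul, h]
    · exact Or.inl fun Q ↦ by rw [pow_succ, mul_smul, h, hF]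

end Algebra

/-! ## §2 Values of a transverse cocycle on the decomposition group are anti-invariant -/

section Values

variable {v : HeightOneSpectrum (𝓞 ℚ)} (W : WeierstrassCurve ℚ) [W.IsElliptic]

/-- **Every value on the decomposition group of the chosen cocycle of a transverse class is anti-invariant under `F`.**
Setting: `q = p^M` prime to `v`; `𝔓` the prime of `\bar ℤ` over `v` cut out by the chosen embedding `ℚ̄ → ℚ̄_v`; `F ∈ Γ_ℚ`
an arithmetic Frobenius at `𝔓` with `F² = 1` on `T = E[q]` and inverting `μ_q` (a Frobenius at a Kolyvagin prime, Gross
(3.2)–(3.3)); `I_𝔓` fixing `T`; `Γ_{ℚ(T)}` open. If `[x, F] = F P₁ − P₁` (`x` TRANSVERSE at `v`), then for every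
`g ∈ Γ_{ℚ_v}`: **`F·[x, res g] = −[x, res g]`**. Proof: `res g = F^k·i·u` (`i ∈ I_𝔓`, `u` in the open kernel of `[x, ·]`),
cocycle identity, `[x, F^k] = F^k P₁ − P₁`, and the anti-invariance of the tame value `[x, i]`
(`smul_h1Eval_eq_neg_of_mem_inertia`). [cite: McCallumLMS1991, §4 Prop. 4.4 (3), §5 Lemma 5.3] [cite: GrossLMS1991, §3 (3.3)] -/
theorem smul_h1Eval_resGal_eq_neg_of_transverse {p M q : ℕ} (hp : p.Prime) (hq : q = p ^ M)
    (hqv : (q : 𝓞 ℚ) ∉ v.asIdeal)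
    {𝔐 : Ideal (HeightOneSpectrum.localAbsIntegers v)} (h𝔐 : 𝔐 ∈ v.localPrimesAbove)
    {F : absoluteGaloisGroup ℚ}
    (hFrob : IsArithFrobAt (𝓞 ℚ) F (v.primeBelow (closureEmb (K := ℚ) (v.adicCompletion ℚ)) 𝔐))
    (hFμ : ∀ ζ : AlgebraicClosure ℚ, ζ ^ q = 1 → F • ζ = ζ⁻¹)
    (hF : ∀ Q : geomTorsion W (q : ℤ), F • F • Q = Q)
    (hI : (v.primeBelow (closureEmb (K := ℚ) (v.adicCompletion ℚ)) 𝔐).inertia (absoluteGaloisGroup ℚ) ≤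
      torsionFixing W (q : ℤ))
    (hopen : IsOpen (torsionFixing W (q : ℤ) : Set (absoluteGaloisGroup ℚ)))
    {x : galH1Torsion W (q : ℤ)} (hx : ∃ P₁ : geomTorsion W (q : ℤ), h1Eval W (q : ℤ) x F = F • P₁ - P₁)
    (g : absoluteGaloisGroup (v.adicCompletion ℚ)) :
    F • h1Eval W (q : ℤ) x (resGal (K := ℚ) (v.adicCompletion ℚ) g) =
      -h1Eval W (q : ℤ) x (resGal (K := ℚ) (v.adicCompletion ℚ) g) := by
  set ι₀ := closureEmb (K := ℚ) (v.adicCompletion ℚ) with hι₀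
  set 𝔓 := v.primeBelow ι₀ 𝔐 with h𝔓def
  have h𝔓 : 𝔓 ∈ v.primesAbove := HeightOneSpectrum.primeBelow_mem_primesAbove h𝔐
  haveI : 𝔓.IsPrime := h𝔓.1
  have hF𝔓 : F • 𝔓 = 𝔓 := MulAction.mem_stabilizer_iff.mp hFrob.mem_stabilizer
  obtain ⟨P₁, hP₁⟩ := hx
  -- `res g ∈ G_𝔓 = ⟨F⟩ · I_𝔓 · U`, `U` the open kernel of `[x, ·]` inside `Γ_{ℚ(T)}`
  have hd : resGal (K := ℚ) (v.adicCompletion ℚ) g ∈ 𝔓.decompositionSubgroup (absoluteGaloisGroup ℚ) := by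
    rw [resGal_eq]; exact resGalOfEmb_mem_decompositionSubgroup ι₀ h𝔐 g
  obtain ⟨k, i, w, hi, hw, hdec⟩ :=
    exists_eq_frobenius_pow_mul_of_mem_decompositionSubgroup h𝔓 hFrob
      (isOpen_evalKer W (q : ℤ) (fun _ : Unit ↦ x) hopen) hd
  have hwfix : w ∈ torsionFixing W (q : ℤ) := hw.1
  have hxw : h1Eval W (q : ℤ) x w = 0 := hw.2 ()
  -- the value at `res g`
  have hval : h1Eval W (q : ℤ) x (resGal (K := ℚ) (v.adicCompletion ℚ) g) =
      (F ^ k • P₁ - P₁) + F ^ k • h1Eval W (q : ℤ) x i := by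
    rw [hdec, h1Eval_mul_smul, h1Eval_mul_smul, hxw, smul_zero, add_zero, h1Eval_pow_eq_smul_sub W (q : ℤ) x hP₁ k]
  -- the tame value is anti-invariant
  have ht : F • h1Eval W (q : ℤ) x i = -h1Eval W (q : ℤ) x i :=
    smul_h1Eval_eq_neg_of_mem_inertia W hp hq hqv h𝔓 hF𝔓 hFμ hI x hi
  rw [hval]
  rcases pow_smul_eq_or W hF k with hk | hk
  · rw [hk, hk, sub_self, zero_add, ht]
  · rw [hk, hk, ht, smul_add, smul_sub, hF, smul_neg, ht, neg_neg]
    abel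

end Values

/-! ## §3 The local cup product of two transverse classes vanishes -/

section Main

variable {v : HeightOneSpectrum (𝓞 ℚ)} (W : WeierstrassCurve ℚ) [W.IsElliptic]

/-- **McCallum's Lemma 5.3, last clause, over `ℚ_ℓ` (any prime power `q = p^M`): two transverse classes have vanishing
local Weil cup product.** Setting of `smul_h1Eval_resGal_eq_neg_of_transverse`, plus: `T = E[q]` free of rank one over
`ℤ/q[F]` on `P` (a REGULAR involution; on `Δ(E) < 0` at a Gross–Kolyvagin prime this is automatic), `e` an alternating
biadditive `Γ_ℚ`-equivariant `μ_q`-valued pairing on `T` (a Weil pairing). If `x, y ∈ H¹(ℚ, E[q])` are TRANSVERSE at `v`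
(`[x, F], [y, F] ∈ (F − 1)T`), then **`loc_v x ∪ₑ loc_v y = 0` in `H²(ℚ_v, μ_q)`**: the restricted cocycles take values in
the isotropic line `T^{F=−1}` (§2, §1), so the cup-product cochain vanishes identically (§0). This is input I7 of the swap
oracle of 3a⁗ (memo `Lines/plus-descent-step-b-prop52.md`) at `p = 2`, where McCallum's odd-`p` argument («skew symmetric and
`Gal(K/ℚ)`-equivalent») is not available. [cite: McCallumLMS1991, §5 Lemma 5.3 and proof of Prop. 5.2 (p. 309)]
[cite: GrossLMS1991, §7 (7.2)] -/
theorem cupProduct_localization_eq_zero_of_transverse {p M q : ℕ} [NeZero q] (hp : p.Prime) (hq : q = p ^ M)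
    (hqv : (q : 𝓞 ℚ) ∉ v.asIdeal)
    {𝔐 : Ideal (HeightOneSpectrum.localAbsIntegers v)} (h𝔐 : 𝔐 ∈ v.localPrimesAbove)
    {F : absoluteGaloisGroup ℚ}
    (hFrob : IsArithFrobAt (𝓞 ℚ) F (v.primeBelow (closureEmb (K := ℚ) (v.adicCompletion ℚ)) 𝔐))
    (hFμ : ∀ ζ : AlgebraicClosure ℚ, ζ ^ q = 1 → F • ζ = ζ⁻¹)
    (hF : ∀ Q : geomTorsion W (q : ℤ), F • F • Q = Q)
    {P : geomTorsion W (q : ℤ)} (hPq : (q : ℤ) • P = 0)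
    (hgen : ∀ Q : geomTorsion W (q : ℤ), ∃ x y : ℤ, Q = x • P + y • F • P)
    (hfree : ∀ x y : ℤ, x • P + y • F • P = 0 → (q : ℤ) ∣ x ∧ (q : ℤ) ∣ y)
    (hI : (v.primeBelow (closureEmb (K := ℚ) (v.adicCompletion ℚ)) 𝔐).inertia (absoluteGaloisGroup ℚ) ≤
      torsionFixing W (q : ℤ))
    (hopen : IsOpen (torsionFixing W (q : ℤ) : Set (absoluteGaloisGroup ℚ)))
    (e : geomTorsion W q → geomTorsion W q → AlgebraicClosure ℚ)
    (hμ : ∀ S T, e S T ^ q = 1) (hadd₁ : ∀ S₁ S₂ T, e (S₁ + S₂) T = e S₁ T * e S₂ T)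
    (hadd₂ : ∀ S T₁ T₂, e S (T₁ + T₂) = e S T₁ * e S T₂) (halt : ∀ T, e T T = 1)
    (hgal : ∀ (σ : absoluteGaloisGroup ℚ) (S T : geomTorsion W q), σ • e S T = e (σ • S) (σ • T))
    {x y : galH1Torsion W (q : ℤ)}
    (hx : ∃ P₁ : geomTorsion W (q : ℤ), h1Eval W (q : ℤ) x F = F • P₁ - P₁)
    (hy : ∃ P₂ : geomTorsion W (q : ℤ), h1Eval W (q : ℤ) y F = F • P₂ - P₂) :
    haveI := absoluteGaloisGroup_compactSpace (v.adicCompletion ℚ)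
    ((weilContPairing W q e hμ hadd₁ hadd₂ hgal).restrict
      (absGaloisRestrict ℚ (v.adicCompletion ℚ))).cupProduct
        (galoisCohomology.localization (W.torsionGaloisModule ((q : ℕ) : ℤ)) (Sum.inr v) 1 x)
        (galoisCohomology.localization (W.torsionGaloisModule ((q : ℕ) : ℤ)) (Sum.inr v) 1 y) = 0 := by
  haveI := absoluteGaloisGroup_compactSpace (v.adicCompletion ℚ)
  -- the localisations are the classes of the restricted chosen cocycles
  have hx' := galoisCohomology.res_oneCocycleClass (W.torsionGaloisModule ((q : ℕ) : ℤ)) (v.adicCompletion ℚ)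
    (reprCocycle W (q : ℤ) x)
  have hy' := galoisCohomology.res_oneCocycleClass (W.torsionGaloisModule ((q : ℕ) : ℤ)) (v.adicCompletion ℚ)
    (reprCocycle W (q : ℤ) y)
  have hcl : ∀ z : galH1Torsion W (q : ℤ),
      oneCocycleClass ((W.torsionGaloisModule ((q : ℕ) : ℤ)).toTopRep) (reprCocycle W (q : ℤ) z) = z :=
    oneCocycleClass_reprCocycle W (q : ℤ)
  rw [hcl] at hx' hy'
  change ((weilContPairing W q e hμ hadd₁ hadd₂ hgal).restrict (absGaloisRestrict ℚ (v.adicCompletion ℚ))).cupProduct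
      (galoisCohomology.res (W.torsionGaloisModule ((q : ℕ) : ℤ)) (v.adicCompletion ℚ) 1 x)
      (galoisCohomology.res (W.torsionGaloisModule ((q : ℕ) : ℤ)) (v.adicCompletion ℚ) 1 y) = 0
  rw [hx', hy']
  refine cupProduct_oneCocycleClass_eq_zero_of_toLin_apply_eq_zero _ _ _ fun a b ↦ ?_
  change weilPairingHom W q e hμ hadd₁ hadd₂
      (h1Eval W (q : ℤ) x (resGal (K := ℚ) (v.adicCompletion ℚ) a))
      (h1Eval W (q : ℤ) y (resGal (K := ℚ) (v.adicCompletion ℚ) b)) = 0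
  exact pairing_eq_zero_of_smul_eq_neg W hF hPq hgen hfree _ (weilPairingHom_self W q e hμ hadd₁ hadd₂ halt)
    (smul_h1Eval_resGal_eq_neg_of_transverse W hp hq hqv h𝔐 hFrob hFμ hF hI hopen hx a)
    (smul_h1Eval_resGal_eq_neg_of_transverse W hp hq hqv h𝔐 hFrob hFμ hF hI hopen hy b)

end Main

/-! ## §4 The packaged form on `Δ(E) < 0` at a Gross–Kolyvagin prime of depth `M` (`p = 2`) -/

section Packaged

variable {v : HeightOneSpectrum (𝓞 ℚ)} (W : WeierstrassCurve ℚ) [W.IsElliptic]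

/-- **I7 at `p = 2` over `ℚ_ℓ`, packaged.** `E = W/ℚ` elliptic with `Δ < 0`, `q = 2^M` (`M ≥ 1`), `ℓ` an odd prime at the
good place `v`, `Frob(ℓ) = Frob(∞)` on `ℚ(E[q])` (`FrobEqFrobInfty W K q ℓ`, a Gross–Kolyvagin prime of depth `M`; `K` is only
carried by the predicate), `e` an alternating biadditive `Γ_ℚ`-equivariant `μ_q`-valued pairing on `E[q]`. If `x, y ∈ H¹(ℚ, E[q])`
are TRANSVERSE AT `v` — `[x, F] ∈ (F − 1)E[q]` for every arithmetic Frobenius `F` at every `𝔓 ∣ v` acting on `E[q]` as a complex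
conjugation (quantified like the reciprocity hypothesis `hR` of `lemma_5_3_descent_of_reciprocity_rat_two`) — then the local
Weil cup product at `v` vanishes: **`loc_v x ∪ₑ loc_v y = 0` in `H²(ℚ_v, μ_q)`**. (McCallum: «`c_v ∈ im(χ_l)` … so again
`c_{M_r+1}(nl′)_v ∪ c_v = 0`», proof of Prop. 5.2, at `p = 2` over `ℚ`.) [cite: McCallumLMS1991, §5 Lemma 5.3 and proof of Prop. 5.2]
[cite: GrossLMS1991, §3 (3.2)–(3.3)] -/
theorem cupProduct_localization_eq_zero_of_transverse_of_Δ_neg (hΔ : W.Δ < 0) {M : ℕ} (hM : 1 ≤ M)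
    {ℓ : ℕ} (hℓ : ℓ.Prime) (hℓ2 : ℓ ≠ 2) (hℓv : (ℓ : 𝓞 ℚ) ∈ v.asIdeal) (hgood : W.HasGoodReductionAt v)
    {K : Type} [Field K] [NumberField K] (hℓM : FrobEqFrobInfty W K (2 ^ M) ℓ)
    (e : geomTorsion W (2 ^ M : ℕ) → geomTorsion W (2 ^ M : ℕ) → AlgebraicClosure ℚ)
    (hμ : ∀ S T, e S T ^ (2 ^ M) = 1) (hadd₁ : ∀ S₁ S₂ T, e (S₁ + S₂) T = e S₁ T * e S₂ T)
    (hadd₂ : ∀ S T₁ T₂, e S (T₁ + T₂) = e S T₁ * e S T₂) (halt : ∀ T, e T T = 1)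
    (hgal : ∀ (σ : absoluteGaloisGroup ℚ) (S T : geomTorsion W (2 ^ M : ℕ)), σ • e S T = e (σ • S) (σ • T))
    {x y : galH1Torsion W ((2 ^ M : ℕ) : ℤ)}
    (hx : ∀ 𝔓 ∈ v.primesAbove, ∀ F c₀ : absoluteGaloisGroup ℚ, IsArithFrobAt (𝓞 ℚ) F 𝔓 →
      IsComplexConjugation (Rat.castHom ℝ) c₀ → (∀ P : geomTorsion W ((2 ^ M : ℕ) : ℤ), F • P = c₀ • P) →
      ∃ P₁ : geomTorsion W ((2 ^ M : ℕ) : ℤ), h1Eval W _ x F = F • P₁ - P₁)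
    (hy : ∀ 𝔓 ∈ v.primesAbove, ∀ F c₀ : absoluteGaloisGroup ℚ, IsArithFrobAt (𝓞 ℚ) F 𝔓 →
      IsComplexConjugation (Rat.castHom ℝ) c₀ → (∀ P : geomTorsion W ((2 ^ M : ℕ) : ℤ), F • P = c₀ • P) →
      ∃ P₂ : geomTorsion W ((2 ^ M : ℕ) : ℤ), h1Eval W _ y F = F • P₂ - P₂) :
    haveI := absoluteGaloisGroup_compactSpace (v.adicCompletion ℚ)
    ((weilContPairing W (2 ^ M) e hμ hadd₁ hadd₂ hgal).restrict
      (absGaloisRestrict ℚ (v.adicCompletion ℚ))).cupProduct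
        (galoisCohomology.localization (W.torsionGaloisModule ((2 ^ M : ℕ) : ℤ)) (Sum.inr v) 1 x)
        (galoisCohomology.localization (W.torsionGaloisModule ((2 ^ M : ℕ) : ℤ)) (Sum.inr v) 1 y) = 0 := by
  -- `2, q ∉ v`; the prime `𝔓` of the chosen embedding; a Frobenius `F` there acting as `c₀`; regular `P`
  have h2v : ((2 : ℕ) : 𝓞 ℚ) ∉ v.asIdeal := two_notMem_of_odd_prime_mem hℓ hℓ2 hℓv
  have hqv' : ((2 ^ M : ℕ) : 𝓞 ℚ) ∉ v.asIdeal := by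
    rw [Nat.cast_pow]
    exact fun h ↦ h2v (v.isPrime.mem_of_pow_mem M h)
  have hqv : ((((2 ^ M : ℕ) : ℤ)) : 𝓞 ℚ) ∉ v.asIdeal := by rwa [Int.cast_natCast]
  have hq0 : (2 ^ M : ℕ) ≠ 0 := pow_ne_zero M two_ne_zero
  have hq0Z : ((2 ^ M : ℕ) : ℤ) ≠ 0 := by exact_mod_cast hq0
  have hwbad : v ∉ W.badPlaces (𝓞 ℚ) := fun h ↦ h hgood
  obtain ⟨𝔐, h𝔐⟩ := v.localPrimesAbove_nonempty
  set 𝔓 := v.primeBelow (closureEmb (K := ℚ) (v.adicCompletion ℚ)) 𝔐 with h𝔓def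
  have h𝔓 : 𝔓 ∈ v.primesAbove := HeightOneSpectrum.primeBelow_mem_primesAbove h𝔐
  haveI : 𝔓.IsPrime := h𝔓.1
  obtain ⟨F, c₀, hFrob, hc₀, hE, -⟩ := FrobEqFrobInfty.exists_at (W := W) (K := K) hℓ hℓM hℓv h𝔓
  obtain ⟨P, hPM, hgen, hfree⟩ := exists_regular_generator_of_Δ_neg W hΔ hc₀ hM
  have hgenF : ∀ Q : geomTorsion W ((2 ^ M : ℕ) : ℤ), ∃ x y : ℤ, Q = x • P + y • F • P := by
    intro Q; rw [hE P]; exact hgen Q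
  have hfreeF : ∀ x y : ℤ, x • P + y • F • P = 0 → ((2 ^ M : ℕ) : ℤ) ∣ x ∧ ((2 ^ M : ℕ) : ℤ) ∣ y := by
    intro x y h; rw [hE P] at h; exact_mod_cast hfree x y h
  have hPq : ((2 ^ M : ℕ) : ℤ) • P = 0 := by exact_mod_cast hPM
  have hF : ∀ Q : geomTorsion W ((2 ^ M : ℕ) : ℤ), F • F • Q = Q := fun Q ↦ by
    rw [hE, hE, ← mul_smul, ← pow_two, hc₀.sq_eq_one, one_smul]
  have hI : 𝔓.inertia (absoluteGaloisGroup ℚ) ≤ torsionFixing W ((2 ^ M : ℕ) : ℤ) :=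
    inertia_le_torsionFixing W hwbad hqv _ h𝔐
  have hopen := isOpen_torsionFixing W hq0Z
  have hFμ : ∀ ζ : AlgebraicClosure ℚ, ζ ^ (2 ^ M) = 1 → F • ζ = ζ⁻¹ := fun ζ hζ ↦
    smul_eq_inv_of_smul_torsion_pow_eq W Nat.prime_two hM rfl hc₀ hE hζ
  exact cupProduct_localization_eq_zero_of_transverse W Nat.prime_two rfl hqv' h𝔐 hFrob hFμ hF hPq hgenF
    hfreeF hI hopen e hμ hadd₁ hadd₂ halt hgal (hx 𝔓 h𝔓 F c₀ hFrob hc₀ hE) (hy 𝔓 h𝔓 F c₀ hFrob hc₀ hE)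

/-- **The `ℓ`-term of the Poitou–Tate sum vanishes for two transverse classes** (same setting): for every family of local
invariant maps `inv` (`LocalInvariants`), `inv_v (loc_v x ∪_{e,v} loc_v y) = 0` — the shape of the terms of
`sum_inv_weilCupProduct_localization_eq_zero` at the own primes `ℓ ∣ n`, `ℓ ≠ ℓ₀`, in McCallum's swap step.
[cite: McCallumLMS1991, §5, proof of Prop. 5.2 (13)] -/
theorem inv_cupProduct_localization_eq_zero_of_transverse_of_Δ_neg (hΔ : W.Δ < 0) {M : ℕ} (hM : 1 ≤ M)
    {ℓ : ℕ} (hℓ : ℓ.Prime) (hℓ2 : ℓ ≠ 2) (hℓv : (ℓ : 𝓞 ℚ) ∈ v.asIdeal) (hgood : W.HasGoodReductionAt v)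
    {K : Type} [Field K] [NumberField K] (hℓM : FrobEqFrobInfty W K (2 ^ M) ℓ)
    (e : geomTorsion W (2 ^ M : ℕ) → geomTorsion W (2 ^ M : ℕ) → AlgebraicClosure ℚ)
    (hμ : ∀ S T, e S T ^ (2 ^ M) = 1) (hadd₁ : ∀ S₁ S₂ T, e (S₁ + S₂) T = e S₁ T * e S₂ T)
    (hadd₂ : ∀ S T₁ T₂, e S (T₁ + T₂) = e S T₁ * e S T₂) (halt : ∀ T, e T T = 1)
    (hgal : ∀ (σ : absoluteGaloisGroup ℚ) (S T : geomTorsion W (2 ^ M : ℕ)), σ • e S T = e (σ • S) (σ • T))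
    (inv : LocalInvariants ℚ (2 ^ M))
    {x y : galH1Torsion W ((2 ^ M : ℕ) : ℤ)}
    (hx : ∀ 𝔓 ∈ v.primesAbove, ∀ F c₀ : absoluteGaloisGroup ℚ, IsArithFrobAt (𝓞 ℚ) F 𝔓 →
      IsComplexConjugation (Rat.castHom ℝ) c₀ → (∀ P : geomTorsion W ((2 ^ M : ℕ) : ℤ), F • P = c₀ • P) →
      ∃ P₁ : geomTorsion W ((2 ^ M : ℕ) : ℤ), h1Eval W _ x F = F • P₁ - P₁)
    (hy : ∀ 𝔓 ∈ v.primesAbove, ∀ F c₀ : absoluteGaloisGroup ℚ, IsArithFrobAt (𝓞 ℚ) F 𝔓 →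
      IsComplexConjugation (Rat.castHom ℝ) c₀ → (∀ P : geomTorsion W ((2 ^ M : ℕ) : ℤ), F • P = c₀ • P) →
      ∃ P₂ : geomTorsion W ((2 ^ M : ℕ) : ℤ), h1Eval W _ y F = F • P₂ - P₂) :
    haveI := absoluteGaloisGroup_compactSpace (Place.Completion (Sum.inr v : Place ℚ))
    inv (Sum.inr v) ((weilContPairingLocal W (2 ^ M) e hμ hadd₁ hadd₂ hgal (Sum.inr v)).cupProduct
      (galoisCohomology.localization (W.torsionGaloisModule ((2 ^ M : ℕ) : ℤ)) (Sum.inr v) 1 x)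
      (galoisCohomology.localization (W.torsionGaloisModule ((2 ^ M : ℕ) : ℤ)) (Sum.inr v) 1 y)) = 0 := by
  haveI := absoluteGaloisGroup_compactSpace (Place.Completion (Sum.inr v : Place ℚ))
  have h := cupProduct_localization_eq_zero_of_transverse_of_Δ_neg W hΔ hM hℓ hℓ2 hℓv hgood hℓM e hμ hadd₁ hadd₂
    halt hgal hx hy
  have h' : (weilContPairingLocal W (2 ^ M) e hμ hadd₁ hadd₂ hgal (Sum.inr v)).cupProduct
      (galoisCohomology.localization (W.torsionGaloisModule ((2 ^ M : ℕ) : ℤ)) (Sum.inr v) 1 x)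
      (galoisCohomology.localization (W.torsionGaloisModule ((2 ^ M : ℕ) : ℤ)) (Sum.inr v) 1 y) = 0 := h
  rw [h']
  exact map_zero _

end Packaged

/-! ## §5 Bridges: how transversality is recognised -/

section Bridges

variable {K : Type u} [Field K] (W : WeierstrassCurve K) {n : ℤ} {F : absoluteGaloisGroup K} {M : ℕ}
  {P : geomTorsion W n}

/-- **Norm criterion**: for `T = E[n]` free of rank one over `ℤ/2^M[F]` on `P`, `x` is transverse at `F` as soon as the NORM
of `[x, F]` vanishes, `[x, F] + F[x, F] = 0` (`Ĥ⁻¹(C₂, ℤ/2^M[F]) = 0`, this lineage's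
`FrobeniusCriterion.exists_eq_smul_sub_iff_norm_eq_zero`). [cite: McCallumLMS1991, §3 (restriction to `L` is injective)] -/
theorem transverse_of_norm_h1Eval_eq_zero (hF : ∀ Q : geomTorsion W n, F • F • Q = Q)
    (hPM : (2 : ℤ) ^ M • P = 0) (hgen : ∀ Q : geomTorsion W n, ∃ x y : ℤ, Q = x • P + y • F • P)
    (hfree : ∀ x y : ℤ, x • P + y • F • P = 0 → (2 : ℤ) ^ M ∣ x ∧ (2 : ℤ) ^ M ∣ y)
    {x : galH1Torsion W n} (hN : h1Eval W n x F + F • h1Eval W n x F = 0) :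
    ∃ P₁ : geomTorsion W n, h1Eval W n x F = F • P₁ - P₁ :=
  (exists_eq_smul_sub_iff_norm_eq_zero W hF hPM hgen hfree _).mpr hN

/-- **Square criterion**: `[x, F²] = [x, F] + F[x, F]` (cocycle identity), so **`[x, F²] = 0 ⟹ x` transverse at `F`** (regular
`T`). This is the shape in which a class `x ∈ H¹(ℚ, E[2^M])` restricting over `K` to a Kolyvagin class `c_M(n)` with `ℓ ∣ n` is
recognised as transverse at `ℓ`: `F² ∈ Γ_K` is a Frobenius of `K_λ` whose image in the dihedral group `Gal(K_λ(ℓ^{1/2^M})/ℚ_ℓ)`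
is trivial, and `c_M(n)_λ ∈ im χ_ℓ` factors through `Gal(K_λ(ℓ^{1/2^M})/K_λ)` (McCallum Prop. 4.4 (1)).
[cite: McCallumLMS1991, §4 Prop. 4.4 (1)] -/
theorem transverse_of_h1Eval_sq_eq_zero (hF : ∀ Q : geomTorsion W n, F • F • Q = Q)
    (hPM : (2 : ℤ) ^ M • P = 0) (hgen : ∀ Q : geomTorsion W n, ∃ x y : ℤ, Q = x • P + y • F • P)
    (hfree : ∀ x y : ℤ, x • P + y • F • P = 0 → (2 : ℤ) ^ M ∣ x ∧ (2 : ℤ) ^ M ∣ y)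
    {x : galH1Torsion W n} (h2 : h1Eval W n x (F * F) = 0) :
    ∃ P₁ : geomTorsion W n, h1Eval W n x F = F • P₁ - P₁ := by
  rw [h1Eval_mul_smul] at h2
  exact transverse_of_norm_h1Eval_eq_zero W hF hPM hgen hfree h2

end Bridges

end Summit.BirchSwinnertonDyer.BirchSwinnertonDyer.Theorems.GenusExact.TransverseIsotropy

end
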